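import Summits.ResolutionOfSingularities.ResolutionOfSingularities.Theorems.FrobeniusClosingPatchingRelPerfectDepthSepTargets
import HarnessLib

/-!
# Chain W5.2 — TargetsF6 v1.2 (plan-1 g9; = v1.1 7001d3757fbb0aa3 with `sepEngine_threefold` / `flagEngineTwo_threefold` re-proved against the
# separation target at `𝒟 := []`, RULING R2a 10:19:07Z — in the tree under the name `SeparationBoundaryNil₃`, module 2 rev 2), module 3 of 3: §7 — the PROVED compositions of the
# non-graded one-form depth-two engine (stage 1 flag tower, stage 2 separation tower, `sepEngine_*`, `flagEngineTwo_*`)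

[OURS · L1 W5.2] PROVED compositions over modules 1–2 (`…DepthFlagTargets`, `…DepthSepTargets`); NOT statements of the manuscript
under review; AI-typed, weaker than expert review.  Crux `PatchingRelPerfect` (stmt-ResolutionOfSingularities-16161), line
`closed_point_slice`, open stub `stub_atomDimFourBlowup` (CORE).  Verbatim §7 of plan-1's file; fact-free (F-32bR enters only as the
hypothesis `hCJS` of `sepEngine_threefold` / `flagEngineTwo_threefold` through `SeparationBoundaryNil₃` = plan-1's v1.2 `SeparationBoundary₃`).

## References (pointers in prose; bib keys of `docs/references.bib`)
* E. Bierstone, D. Grigoriev, P. Milman, J. Włodarczyk, *Effective Hironaka resolution and its complexity*, Asian J. Math. 15 (2011),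
  §3.2 Lemma 3.2.1. [BierstoneGrigorievMilmanWlodarczyk2011]
* J. Kollár, *Lectures on Resolution of Singularities* (2007), (3.111) Step 3; 3.30.2. [Kollar2007]
* V. Cossart, U. Jannsen, S. Saito, *Desingularization: invariants and strategy*, LNM 2270 (2020), Thm. 1.4. [CossartJannsenSaito2020]
* The Stacks Project, Tag 080A. [StacksProject]
-/

set_option linter.dupNamespace false

noncomputable section

open CategoryTheory CategoryTheory.Limits AlgebraicGeometry TopologicalSpace
open Literature.AlgebraicGeometry.Resolution
open Scheme.IdealSheafData

namespace Summit.ResolutionOfSingularities.ResolutionOfSingularities.Theorems.DepthTargets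

universe u

/-! ## §7 PROVED compositions (filer: may be split into a `…Compositions` module) -/

/-! ### §7.1 Stage 1 -/

/-- Forgetting the first flag term: an `IsFlagSeq` is a pure weight-two sequence on `𝔟` (factor law
`IsBlowup.pow_mul_controlledTransform_eq`). [cite: BierstoneGrigorievMilmanWlodarczyk2011, §3.2 Lemma 3.2.1] -/
theorem IsFlagSeq.isPureWeightedSeq :
    ∀ {E' E : Scheme.{u}} {ρ : E' ⟶ E} {𝔟 R₁ : E.IdealSheafData} {𝔟' R₁' : E'.IdealSheafData},
      IsFlagSeq ρ 𝔟 R₁ 𝔟' R₁' → IsPureWeightedSeq 2 ρ 𝔟 𝔟'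
  | _, _, _, _, _, _, _, .nil 𝔟 R₁ => .nil 𝔟
  | _, _, _, _, _, _, _, .cons τ ρ 𝔟 R₁ 𝔟' R₁' C h hC hle _ hτ => by
    refine .cons τ ρ 𝔟 𝔟' _ C h.isPureWeightedSeq hC hle hτ ?_
    refine (hτ.pow_mul_controlledTransform_eq ?_).symm
    have h' : 𝔟'.comap τ ≤ (C ^ 2).comap τ := Scheme.IdealSheafData.comap_mono (f := τ) hle
    rwa [comap_pow] at h'

/-- The flag shape `𝔟 ≤ R₁` is preserved (by construction of the law `R₁'' = τᶜ(𝔟', 2) ⊔ τᶜ(R₁', 1)`). [folklore] -/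
theorem IsFlagSeq.le :
    ∀ {E' E : Scheme.{u}} {ρ : E' ⟶ E} {𝔟 R₁ : E.IdealSheafData} {𝔟' R₁' : E'.IdealSheafData},
      IsFlagSeq ρ 𝔟 R₁ 𝔟' R₁' → 𝔟 ≤ R₁ → 𝔟' ≤ R₁'
  | _, _, _, _, _, _, _, .nil 𝔟 R₁, h => h
  | _, _, _, _, _, _, _, .cons τ ρ 𝔟 R₁ 𝔟' R₁' C _ _ _ _ _, _ => le_sup_left

/-- **Concatenation of flag sequences** (stage 1 = pre-phase THEN scoped phase). [folklore] -/
theorem IsFlagSeq.trans {E'' E' E : Scheme.{u}} {ρ : E' ⟶ E} {ρ' : E'' ⟶ E'} {𝔟 R₁ : E.IdealSheafData}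
    {𝔟' R₁' : E'.IdealSheafData} {𝔟'' R₁'' : E''.IdealSheafData}
    (h : IsFlagSeq ρ 𝔟 R₁ 𝔟' R₁') (h' : IsFlagSeq ρ' 𝔟' R₁' 𝔟'' R₁'') : IsFlagSeq (ρ' ≫ ρ) 𝔟 R₁ 𝔟'' R₁'' := by
  have key : ∀ {F'' F' : Scheme.{u}} {ρ' : F'' ⟶ F'} {b r : F'.IdealSheafData} {b'' r'' : F''.IdealSheafData},
      IsFlagSeq ρ' b r b'' r'' →
      ∀ {F : Scheme.{u}} (ρ : F' ⟶ F) (𝔟 R₁ : F.IdealSheafData), IsFlagSeq ρ 𝔟 R₁ b r →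
        IsFlagSeq (ρ' ≫ ρ) 𝔟 R₁ b'' r'' := by
    intro F'' F' ρ' b r b'' r'' hseq
    induction hseq with
    | nil b r =>
      intro F ρ 𝔟 R₁ h
      simpa using h
    | cons τ ρ' b r b₁ r₁ C hρ' hC hle hR hτ ih =>
      intro F ρ 𝔟 R₁ h
      simpa only [Category.assoc] using IsFlagSeq.cons τ (ρ' ≫ ρ) 𝔟 R₁ b₁ r₁ C (ih ρ 𝔟 R₁ h) hC hle hR hτ
  exact key h' ρ 𝔟 R₁ h

/-- **PROVED COMPOSITION — T6-E1 from its two halves**: divisorial pre-phase, then the scoped order reduction, concatenated. Fact-free.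
[folklore] -/
theorem stageOneFlag₃_of_prephase_of_scoped (hpre : StageOnePrephase₃.{u}) (hsc : StageOneFlagScoped₃.{u}) :
    StageOneFlag₃.{u} := by
  intro E _ _ hreg hexc hdim 𝔟 R₁ hne hlp hle
  obtain ⟨E₁, ρ, 𝔟₁, R₁₁, hseq, ⟨hint, hnoeth, hreg₁, hexc₁, hdim₁, hne₁, hlp₁, hle₁⟩, hscope⟩ :=
    hpre E hreg hexc hdim 𝔟 R₁ hne hlp hle
  haveI := hint
  haveI := hnoeth
  obtain ⟨E₂, ρ', 𝔟₂, R₁₂, hseq', hst, hend⟩ := hsc E₁ hreg₁ hexc₁ hdim₁ 𝔟₁ R₁₁ hne₁ hlp₁ hle₁ hscope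
  exact ⟨E₂, ρ' ≫ ρ, 𝔟₂, R₁₂, hseq.trans hseq', hst, hend⟩

/-- **Iterating formatted weight-two steps along an `IsFlagSeq`** (induction, as `towerPow_of_stepPow`): the X-side sequence is
a pure weight-two sequence along the centres `i_j(C_j)`. [cite: BierstoneGrigorievMilmanWlodarczyk2011, §3.2 Lemma 3.2.1]
[cite: Kollar2007, (3.111) Step 3] -/
theorem towerFlagTwo_of_stepFlagTwo
    {Q₁ : ∀ ⦃E X : Scheme.{u}⦄, (E ⟶ X) → X.IdealSheafData → E.IdealSheafData → Prop}
    (hstep : StepFlagTwo Q₁) : TowerFlagTwo Q₁ := by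
  have key : ∀ {E' E : Scheme.{u}} {ρ : E' ⟶ E} {𝔟 R₁ : E.IdealSheafData} {𝔟' R₁' : E'.IdealSheafData},
      IsFlagSeq ρ 𝔟 R₁ 𝔟' R₁' →
      ∀ (S : Type u) [CommRing S] [IsRegularLocalRing S] (I : Ideal S) (X : Scheme.{u}) (i : E ⟶ X)
        (g : X ⟶ Spec (.of S)) (K : X.IdealSheafData),
        DepthInvariant 2 S I E X i g K → Q₁ i K R₁ → K.comap i = 𝔟 →
        ∃ (X' : Scheme.{u}) (π : X' ⟶ X) (i' : E' ⟶ X') (K' : X'.IdealSheafData),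
          IsPureWeightedSeq 2 π K K' ∧ i' ≫ π = ρ ≫ i ∧
          DepthInvariant 2 S I E' X' i' (π ≫ g) K' ∧ K'.comap i' = 𝔟' ∧ Q₁ i' K' R₁' := by
    intro E' E ρ 𝔟 R₁ 𝔟' R₁' hseq
    induction hseq with
    | nil 𝔟 R₁ =>
      intro S _ _ I X i g K hinv hQ h𝔟
      exact ⟨X, 𝟙 X, i, K, .nil K, by simp, by simpa using hinv, h𝔟, hQ⟩
    | cons τ ρ 𝔟 R₁ 𝔟₁ R₁₁ C hρ hC hle hR hτ ih =>
      intro S _ _ I X i g K hinv hQ h𝔟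
      obtain ⟨X₁, π, i₁, K₁, hXseq, hsq, hinv₁, hK₁, hQ₁⟩ := ih S I X i g K hinv hQ h𝔟
      have hle' : K₁.comap i₁ ≤ C ^ 2 := hK₁ ▸ hle
      obtain ⟨hperm, X₂, σ, i₂, hσ, hsq₂, hinv₂, hK₂, hQ₂⟩ :=
        hstep S I _ X₁ i₁ (π ≫ g) K₁ R₁₁ hinv₁ hQ₁ _ τ C hC hle' hR hτ
      haveI := hinv₁.isClosedImmersion
      refine ⟨X₂, σ ≫ π, i₂, controlledTransform σ (C.map i₁) K₁ 2, ?_, ?_, ?_, ?_, ?_⟩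
      · refine .cons σ π K K₁ _ (C.map i₁) hXseq (DepthOne.isRegular_subscheme_map i₁ C hC) hperm hσ ?_
        refine (hσ.pow_mul_controlledTransform_eq ?_).symm
        have h : K₁.comap σ ≤ ((C.map i₁) ^ 2).comap σ :=
          Scheme.IdealSheafData.comap_mono (f := σ) hperm
        rwa [comap_pow] at h
      · rw [Category.assoc, ← hsq, ← Category.assoc, hsq₂, Category.assoc]
      · rw [Category.assoc]; exact hinv₂
      · rw [hK₂, hK₁]
      · rw [hK₁] at hQ₂; exact hQ₂
  intro S _ _ I E X i g K R₁ hinv hQ E' ρ 𝔟' R₁' hseq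
  exact key hseq S I X i g K hinv hQ rfl

/-! ### §7.2 Stage 2 (part S v0 proofs, unchanged) -/

/-- Forgetting the boundary: an `IsSepSeq` is a weighted sequence with weights `≤ 2` (each step has weight `1`); factor law
`IsBlowup.pow_mul_controlledTransform_eq`. [cite: BierstoneGrigorievMilmanWlodarczyk2011, §3.2 Lemma 3.2.1] -/
theorem IsSepSeq.isWeightedSeq :
    ∀ {E' E : Scheme.{u}} {ρ : E' ⟶ E} {𝔟 : E.IdealSheafData} {𝒟 : List (E.IdealSheafData × ℕ)}
      {𝔟' : E'.IdealSheafData} {𝒟' : List (E'.IdealSheafData × ℕ)},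
      IsSepSeq ρ 𝔟 𝒟 𝔟' 𝒟' → IsWeightedSeq 2 ρ 𝔟 𝔟'
  | _, _, _, _, _, _, _, .nil 𝔟 𝒟 => .nil 𝔟
  | _, _, _, _, _, _, _, .cons τ ρ 𝔟 𝒟 𝔟' 𝒟' C h hC _ hle _ _ _ hτ => by
    refine .cons τ ρ 𝔟 𝔟' _ C 1 h.isWeightedSeq hC le_rfl (by norm_num) (by simpa using hle) hτ ?_
    refine (hτ.pow_mul_controlledTransform_eq ?_).symm
    have h' : 𝔟'.comap τ ≤ (C ^ 1).comap τ := Scheme.IdealSheafData.comap_mono (f := τ) (by simpa using hle)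
    rwa [comap_pow] at h'

/-- **Iterating formatted weight-one steps along an `IsSepSeq`** (induction, as `towerMixedJ_of_stepMixedJ`).
[cite: BierstoneGrigorievMilmanWlodarczyk2011, §3.2 Lemma 3.2.1] -/
theorem towerSep_of_stepSepOne
    {Q : ∀ ⦃E X : Scheme.{u}⦄, (E ⟶ X) → X.IdealSheafData → X.IdealSheafData → List (E.IdealSheafData × ℕ) → Prop}
    (hstep : StepSepOne Q) : TowerSep Q := by
  have key : ∀ {E' E : Scheme.{u}} {ρ : E' ⟶ E} {𝔟 : E.IdealSheafData} {𝒟 : List (E.IdealSheafData × ℕ)}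
      {𝔟' : E'.IdealSheafData} {𝒟' : List (E'.IdealSheafData × ℕ)},
      IsSepSeq ρ 𝔟 𝒟 𝔟' 𝒟' →
      ∀ (S : Type u) [CommRing S] [IsRegularLocalRing S] (I : Ideal S) (X : Scheme.{u}) (i : E ⟶ X)
        (g : X ⟶ Spec (.of S)) (K N : X.IdealSheafData),
        DepthInvariantMono 2 S I E X i g K N → Q i K N 𝒟 → K.comap i = 𝔟 →
        ∃ (X' : Scheme.{u}) (π : X' ⟶ X) (i' : E' ⟶ X') (K' N' : X'.IdealSheafData),
          IsWeightedSeq 2 π K K' ∧ i' ≫ π = ρ ≫ i ∧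
          DepthInvariantMono 2 S I E' X' i' (π ≫ g) K' N' ∧ K'.comap i' = 𝔟' ∧ Q i' K' N' 𝒟' := by
    intro E' E ρ 𝔟 𝒟 𝔟' 𝒟' hseq
    induction hseq with
    | nil 𝔟 𝒟 =>
      intro S _ _ I X i g K N hinv hQ h𝔟
      exact ⟨X, 𝟙 X, i, K, N, .nil K, by simp, by simpa using hinv, h𝔟, hQ⟩
    | cons τ ρ 𝔟 𝒟 𝔟₁ 𝒟₁ C hρ hC hconn hle hsnc hU hjoint hτ ih =>
      intro S _ _ I X i g K N hinv hQ h𝔟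
      obtain ⟨X₁, π, i₁, K₁, N₁, hXseq, hsq, hinv₁, hK₁, hQ₁⟩ := ih S I X i g K N hinv hQ h𝔟
      have hle' : K₁.comap i₁ ≤ C := hK₁ ▸ hle
      have hjoint' : ∀ z : _, z ∈ C.support → OrdLeOneAt (K₁.comap i₁) z → SepJointAt (K₁.comap i₁) C 𝒟₁ z := by
        rw [hK₁]; exact hjoint
      obtain ⟨hperm, X₂, σ, i₂, hσ, hsq₂, hinv₂, hK₂, hQ₂⟩ :=
        hstep S I _ X₁ i₁ (π ≫ g) K₁ N₁ 𝒟₁ hinv₁ hQ₁ _ τ C hC hconn hle' hsnc hU hjoint' hτ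
      haveI := hinv₁.isClosedImmersion
      refine ⟨X₂, σ ≫ π, i₂, controlledTransform σ (C.map i₁) K₁ 1,
        N₁.comap σ * (C.map i₁).comap σ ^ (2 - 1), ?_, ?_, ?_, ?_, hQ₂⟩
      · refine .cons σ π K K₁ _ (C.map i₁) 1 hXseq (DepthOne.isRegular_subscheme_map i₁ C hC) le_rfl (by norm_num)
          hperm hσ ?_
        refine (hσ.pow_mul_controlledTransform_eq ?_).symm
        have h : K₁.comap σ ≤ ((C.map i₁) ^ 1).comap σ :=
          Scheme.IdealSheafData.comap_mono (f := σ) hperm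
        rwa [comap_pow] at h
      · rw [Category.assoc, ← hsq, ← Category.assoc, hsq₂, Category.assoc]
      · rw [Category.assoc]; exact hinv₂
      · rw [hK₂, hK₁]
  intro S _ _ I E X i g K N 𝒟 hinv hQ E' ρ 𝔟' 𝒟' hseq
  exact key hseq S I X i g K N hinv hQ rfl

/-- **PROVED COMPOSITION — the stage-2 engine from its targets**: tower along the E-side `IsSepSeq` ⇒ two-monomial
presentation at the `EndSep` state ⇒ pointwise pair game ⇒ D5 (`atomConclusion_of_pointwiseTwoMonomial`, J module). Fact-free.
[cite: Kollar2007, (3.111) Step 3] -/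
theorem sepEngine_of_targets
    (Q : ∀ ⦃E X : Scheme.{u}⦄, (E ⟶ X) → X.IdealSheafData → X.IdealSheafData → List (E.IdealSheafData × ℕ) → Prop)
    (htower : TowerSep Q) (hend : EndTwoMonomialSep Q) (hpair : PointwisePairGame.{u}) : SepEngine.{u} Q := by
  intro S _ _ I hI E X i g K N 𝒟 hinv hQ hE T f hf
  obtain ⟨E', ρ, 𝔟', 𝒟', hseq, hendE⟩ := hE
  obtain ⟨X', π, i', K', N', -, -, hinv', hK', hQ'⟩ := htower S I E X i g K N 𝒟 hinv hQ E' ρ 𝔟' 𝒟' hseq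
  obtain ⟨M₀, A, B, hM₀, hAB, hsnc, hK'eq⟩ := hend S I E' X' i' (π ≫ g) K' N' 𝒟' hinv' hQ' (hK' ▸ hendE)
  exact atomConclusion_of_pointwiseTwoMonomial hpair hI hinv' hM₀ hAB hsnc hK'eq T f hf

/-- **The stage-2 engine with the E-side supplied by T6-E2** (PROVED composition; v1.2: at the EMPTY boundary): at any state in
format `Q` with `𝒟 = []` whose exceptional scheme is an integral Noetherian regular excellent threefold and whose E-side datum is
non-zero and locally principal, the conclusion of the CORE holds — modulo F-32bR (inside `SeparationBoundaryNil₃` only; = plan-1's v1.2 `SeparationBoundary₃`).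
[cite: CossartJannsenSaito2020, Thm. 1.4] [cite: Kollar2007, (3.111) Step 3] -/
theorem sepEngine_threefold
    (Q : ∀ ⦃E X : Scheme.{u}⦄, (E ⟶ X) → X.IdealSheafData → X.IdealSheafData → List (E.IdealSheafData × ℕ) → Prop)
    (htower : TowerSep Q) (hend : EndTwoMonomialSep Q) (hpair : PointwisePairGame.{u})
    (hSep : SeparationBoundaryNil₃.{u}) (hCJS : CossartJannsenSaito2020EmbeddedSequenceB.{u})
    {S : Type u} [CommRing S] [IsRegularLocalRing S] {I : Ideal S} (hI : I ≠ ⊥)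
    {E X : Scheme.{u}} [IsIntegral E] [IsNoetherian E] (hexc : Scheme.IsExcellent E) (hdim : topologicalKrullDim E = 3)
    {i : E ⟶ X} {g : X ⟶ Spec (.of S)} {K N : X.IdealSheafData}
    (hinv : DepthInvariantMono 2 S I E X i g K N) (hQ : Q i K N ([] : List (E.IdealSheafData × ℕ)))
    (hK : K.comap i ≠ ⊥) (hlp : IsLocallyPrincipal (K.comap i))
    (T : Scheme.{u}) (f : T ⟶ Spec (.of S)) (hf : IsBlowup f (affineBlowup.idealSheaf I)) :
    ∃ (J : T.IdealSheafData) (T' : Scheme.{u}) (π : T' ⟶ T), J ≠ ⊥ ∧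
      (∀ t : T, t ∈ J.support → f.base t = IsLocalRing.closedPoint S) ∧
      IsBlowup π J ∧ Scheme.IsRegular T' := by
  obtain ⟨E', ρ, 𝔟', 𝒟', hseq, -, -, -, hend'⟩ :=
    hSep hCJS E hinv.isRegular_exc hexc hdim (K.comap i) hK hlp
  exact sepEngine_of_targets Q htower hend hpair S I hI E X i g K N [] hinv hQ ⟨E', ρ, 𝔟', 𝒟', hseq, hend'⟩ T f hf


/-! ### §7.3 The F6 engine -/

/-- **PROVED COMPOSITION — the F6 engine from its targets**: stage-1 tower (literal contact) ⇒ junction (KEY OBSERVATION) ⇒ the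
stage-2 engine at the junction state with `N = ⊤`, `𝒟 = []` (`DepthInvariantMono.of_depthInvariant`). Fact-free.
[cite: Kollar2007, (3.111) Step 3] [cite: KawanoueMatsuki2016, §2] -/
theorem flagEngineTwo_of_targets
    (Q₁ : ∀ ⦃E X : Scheme.{u}⦄, (E ⟶ X) → X.IdealSheafData → E.IdealSheafData → Prop)
    (Q : ∀ ⦃E X : Scheme.{u}⦄, (E ⟶ X) → X.IdealSheafData → X.IdealSheafData → List (E.IdealSheafData × ℕ) → Prop)
    (htower₁ : TowerFlagTwo Q₁) (hinit : InitialSep Q₁ Q) (htower : TowerSep Q) (hend : EndTwoMonomialSep Q)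
    (hpair : PointwisePairGame.{u}) : FlagEngineTwo.{u} Q₁ := by
  intro S _ _ I hI E X i g K R₁ hinv hQ₁ hE T f hf
  obtain ⟨E', ρ, 𝔟', R₁', hseq, hend₁, E'', ρ', 𝔟'', 𝒟'', hseq₂, hend₂⟩ := hE
  obtain ⟨X', π, i', K', -, -, hinv', hK', hQ₁'⟩ := htower₁ S I E X i g K R₁ hinv hQ₁ E' ρ 𝔟' R₁' hseq
  have hflag : EndFlag (K'.comap i') R₁' := by rw [hK']; exact hend₁
  have hQ' : Q i' K' ⊤ ([] : List (E'.IdealSheafData × ℕ)) := hinit S I E' X' i' (π ≫ g) K' R₁' hinv' hQ₁' hflag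
  have hseq₂' : IsSepSeq ρ' (K'.comap i') ([] : List (E'.IdealSheafData × ℕ)) 𝔟'' 𝒟'' := by rw [hK']; exact hseq₂
  exact sepEngine_of_targets Q htower hend hpair S I hI E' X' i' (π ≫ g) K' ⊤ []
    (DepthInvariantMono.of_depthInvariant hinv') hQ'
    ⟨E'', ρ', 𝔟'', 𝒟'', hseq₂', hend₂⟩ T f hf

/-- **The F6 engine with BOTH E-sides supplied** (PROVED composition): at any stage-1 state in format `Q₁` whose exceptional scheme
is an integral Noetherian excellent threefold and whose flag `K|_E ≤ R₁` has `K|_E` non-zero and locally principal, the conclusion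
of the CORE holds — given the X-side targets for `(Q₁, Q)`, T6-E1 `StageOneFlag₃` (fact-free target; its scoped half's closer is
CONDITIONAL on F-33 in its own module) and T6-E2 `SeparationBoundaryNil₃` modulo F-32bR (plan-1's v1.2 `SeparationBoundary₃`: stated at the junction boundary `[]`,
which is exactly what is fed here). [cite: CossartJannsenSaito2020, Thm. 1.4] [cite: Kollar2007, (3.111) Step 3] -/
theorem flagEngineTwo_threefold
    (Q₁ : ∀ ⦃E X : Scheme.{u}⦄, (E ⟶ X) → X.IdealSheafData → E.IdealSheafData → Prop)
    (Q : ∀ ⦃E X : Scheme.{u}⦄, (E ⟶ X) → X.IdealSheafData → X.IdealSheafData → List (E.IdealSheafData × ℕ) → Prop)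
    (htower₁ : TowerFlagTwo Q₁) (hinit : InitialSep Q₁ Q) (htower : TowerSep Q) (hend : EndTwoMonomialSep Q)
    (hpair : PointwisePairGame.{u})
    (hE1 : StageOneFlag₃.{u}) (hSep : SeparationBoundaryNil₃.{u}) (hCJS : CossartJannsenSaito2020EmbeddedSequenceB.{u})
    {S : Type u} [CommRing S] [IsRegularLocalRing S] {I : Ideal S} (hI : I ≠ ⊥)
    {E X : Scheme.{u}} [IsIntegral E] [IsNoetherian E] (hexc : Scheme.IsExcellent E) (hdim : topologicalKrullDim E = 3)
    {i : E ⟶ X} {g : X ⟶ Spec (.of S)} {K : X.IdealSheafData} {R₁ : E.IdealSheafData}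
    (hinv : DepthInvariant 2 S I E X i g K) (hQ₁ : Q₁ i K R₁)
    (hK : K.comap i ≠ ⊥) (hlp : IsLocallyPrincipal (K.comap i)) (hR : K.comap i ≤ R₁)
    (T : Scheme.{u}) (f : T ⟶ Spec (.of S)) (hf : IsBlowup f (affineBlowup.idealSheaf I)) :
    ∃ (J : T.IdealSheafData) (T' : Scheme.{u}) (π : T' ⟶ T), J ≠ ⊥ ∧
      (∀ t : T, t ∈ J.support → f.base t = IsLocalRing.closedPoint S) ∧
      IsBlowup π J ∧ Scheme.IsRegular T' := by
  obtain ⟨E', ρ, 𝔟', R₁', hseq, ⟨hint, hnoeth, hreg', hexc', hdim', hne, hlp', -⟩, hend₁⟩ :=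
    hE1 E hinv.isRegular_exc hexc hdim (K.comap i) R₁ hK hlp hR
  haveI := hint
  haveI := hnoeth
  obtain ⟨E'', ρ', 𝔟'', 𝒟'', hseq₂, -, -, -, hend₂⟩ :=
    hSep hCJS E' hreg' hexc' hdim' 𝔟' hne hlp'
  exact flagEngineTwo_of_targets Q₁ Q htower₁ hinit htower hend hpair S I hI E X i g K R₁ hinv hQ₁
    ⟨E', ρ, 𝔟', R₁', hseq, hend₁, E'', ρ', 𝔟'', 𝒟'', hseq₂, hend₂⟩ T f hf


end Summit.ResolutionOfSingularities.ResolutionOfSingularities.Theorems.DepthTargets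

end
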